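import Mathlib
import HarnessLib
import Literature.NumberTheory.Transcendental.LindemannWeierstrassProofs
import Summits.Schanuel.Schanuel.Theses.DiophantineDichotomy

/-!
# Route `DiophantineDichotomy` — the exponent race `ApproximationRace` (stmt-Schanuel-6119)

`Summit.Schanuel.Schanuel.Theses.DiophantineDichotomy.ApproximationRace` is the support item
`ApproximationProperty → KhovanskiiApproxType → KhovanskiiSchanuel` of route `DiophantineDichotomy`:
Philippon's approximation property in transcendence degree `t` (crux `ApproximationProperty`) and a
measure of simultaneous algebraic approximation with degree exponent `a < 1/(n−1)` at every free
Khovanskii point `θ = (s, e^s) ∈ ℂ²ⁿ` (crux `KhovanskiiApproxType`) together give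
`trdeg_ℚ ℚ(s, e^s) ≥ n` at every such point (target `KhovanskiiSchanuel`).

Proof (as in the item text; the mechanism is Philippon's "measure + approximation property ⇒ large
transcendence degree", Nesterenko–Philippon, LNM 1752 (2001), Ch. 4 §4, after Prop. 4.1):
* `n = 0`: trivial;
* `n = 1`: `s 0 ≠ 0`; either `s 0` is transcendental, or it is algebraic and then `e^{s 0}` is
  transcendental by Hermite–Lindemann (the tree's
  `Literature.NumberTheory.Transcendental.transcendental_exp_holds`); either way `ℚ(s 0, e^{s 0})`
  contains a transcendental element, so its transcendence degree is `≥ 1`;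
* `n ≥ 2`: if `trdeg < n` then `trdeg ≤ n − 1`, so the approximation property with `t = n − 1` at
  `θ = (s, e^s)` (index type `Fin n ⊕ Fin n`, `range θ = range s ∪ range (exp ∘ s)`) supplies, for all
  `Y ≥ Δ ≥ c`, algebraic `γ` with `1 ≤ d ≤ (cΔ)^t`, `H ≥ 1` and
  `‖γ − θ‖ ≤ exp(−(Δ log H + dY)/c)`, while the measure gives
  `‖γ − θ‖ ≥ exp(−C(dᵃ log H + dᵇ))`; hence `Δ log H + dY ≤ cC(dᵃ log H + dᵇ)`. THE RACE
  (`race`, elementary real analysis): with `A = max a 0 < 1/t`, `B = max b 0`, one has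
  `cC dᵃ ≤ cC (cΔ)^{tA} ≤ Δ` once `Δ^{1−tA} ≥ cC c^{tA}` (possible as `1 − tA > 0`), and
  `cC dᵇ ≤ cC (cΔ)^{tB} < Y ≤ dY` for `Y = max Δ (cC(cΔ)^{tB} + 1)`; so
  `cC(dᵃ log H + dᵇ) < Δ log H + dY`, a contradiction. (The bound `log H ≤ cYΔ^{t−1}` of the
  approximation property is not even needed.)

No new definitions; the only non-Mathlib input is Hermite–Lindemann (proved in the tree).
-/

-- `Summit.Schanuel.Schanuel.…` is the mandated summit/sub-problem namespace (single-conjunct summit), hence: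
set_option linter.dupNamespace false

namespace Summit.Schanuel.Schanuel.Theorems

open Summit.Schanuel.Schanuel.Theses.DiophantineDichotomy

/-! ## Elementary lemmas -/

/-- A transcendental element of an intermediate field `L ⊆ ℂ` over `ℚ` forces `trdeg_ℚ L ≥ 1`.
[folklore] -/
theorem ApproximationRace.one_le_trdeg_of_mem {L : IntermediateField ℚ ℂ} {w : ℂ} (hw : w ∈ L)
    (ht : Transcendental ℚ w) : (1 : Cardinal) ≤ Algebra.trdeg ℚ L := by
  haveI : Algebra.Transcendental ℚ L :=
    ⟨⟨⟨w, hw⟩, fun h => ht (IntermediateField.isAlgebraic_iff.mp h)⟩⟩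
  exact Cardinal.one_le_iff_pos.mpr (trdeg_pos ℚ L)

/-- A complex root of a non-zero integer polynomial of degree `≤ d` forces `1 ≤ d`
(a non-zero constant has no root). [folklore] -/
theorem ApproximationRace.one_le_of_root {P : Polynomial ℤ} {d : ℕ} {z : ℂ} (hP : P ≠ 0)
    (hdeg : P.natDegree ≤ d) (hz : Polynomial.aeval z P = 0) : 1 ≤ d := by
  by_contra hd
  have hd0 : P.natDegree = 0 := by omega
  rw [Polynomial.eq_C_of_natDegree_eq_zero hd0, Polynomial.aeval_C, eq_intCast, Int.cast_eq_zero] at hz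
  apply hP
  rw [Polynomial.eq_C_of_natDegree_eq_zero hd0, hz, map_zero]

/-- A non-zero integer polynomial with all coefficients of absolute value `≤ H` forces `1 ≤ H`.
[folklore] -/
theorem ApproximationRace.one_le_height {P : Polynomial ℤ} {H : ℕ} (hP : P ≠ 0)
    (hH : ∀ k, |P.coeff k| ≤ (H : ℤ)) : 1 ≤ H := by
  have hlc : P.leadingCoeff ≠ 0 := Polynomial.leadingCoeff_ne_zero.mpr hP
  have h1 : (1 : ℤ) ≤ |P.leadingCoeff| := Int.one_le_abs hlc
  have h2 : |P.leadingCoeff| ≤ (H : ℤ) := hH P.natDegree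
  exact_mod_cast h1.trans h2

/-- THE RACE (pure real analysis).  For `t ≥ 1`, `c ≥ 1`, `C > 0` and a degree exponent `a < 1/t`
there are scales `Y ≥ Δ ≥ c` at which no `d ≥ 1`, `H ≥ 1` with `d ≤ (cΔ)^t` can satisfy
`Δ·log H + d·Y ≤ cC(dᵃ log H + dᵇ)`. [folklore] -/
theorem ApproximationRace.race {t : ℕ} (ht : 1 ≤ t) {c C a b : ℝ} (hc : 1 ≤ c) (hC : 0 < C)
    (ha : a < 1 / (t : ℝ)) :
    ∃ Δ Y : ℝ, c ≤ Δ ∧ Δ ≤ Y ∧ ∀ d H : ℕ, 1 ≤ d → 1 ≤ H → (d : ℝ) ≤ (c * Δ) ^ t →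
      c * (C * ((d : ℝ) ^ a * Real.log H + (d : ℝ) ^ b)) < Real.log H * Δ + d * Y := by
  set A : ℝ := max a 0 with hA
  set B : ℝ := max b 0 with hB
  have htpos : (0 : ℝ) < t := by exact_mod_cast ht
  have hA0 : 0 ≤ A := le_max_right _ _
  have hB0 : 0 ≤ B := le_max_right _ _
  have hAt : (t : ℝ) * A < 1 := by
    have hA' : A < 1 / (t : ℝ) := max_lt ha (by positivity)
    calc (t : ℝ) * A < t * (1 / t) := mul_lt_mul_of_pos_left hA' htpos
      _ = 1 := mul_one_div_cancel htpos.ne'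
  set e : ℝ := 1 - t * A with he
  have hepos : 0 < e := by rw [he]; linarith
  have hcpos : 0 < c := lt_of_lt_of_le one_pos hc
  set M : ℝ := c * C * c ^ ((t : ℝ) * A) with hM
  -- choose Δ ≥ c with Δ ^ e ≥ M
  have hev : ∀ᶠ Δ in Filter.atTop, c ≤ Δ ∧ M ≤ Δ ^ e :=
    (Filter.eventually_ge_atTop c).and ((tendsto_rpow_atTop hepos).eventually_ge_atTop M)
  obtain ⟨Δ, hcΔ, hMΔ⟩ := hev.exists
  have hΔpos : 0 < Δ := lt_of_lt_of_le hcpos hcΔ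
  have hcΔpos : 0 < c * Δ := mul_pos hcpos hΔpos
  set Y : ℝ := max Δ (c * C * (c * Δ) ^ ((t : ℝ) * B) + 1) with hY
  refine ⟨Δ, Y, hcΔ, le_max_left _ _, fun d H hd hH hdle => ?_⟩
  have hd1 : (1 : ℝ) ≤ d := by exact_mod_cast hd
  have hd0 : (0 : ℝ) ≤ d := by positivity
  have hH1 : (1 : ℝ) ≤ H := by exact_mod_cast hH
  have hL : 0 ≤ Real.log H := Real.log_nonneg hH1
  have hcC : 0 ≤ c * C := by positivity
  -- monotonicity in the exponents (base `d ≥ 1`)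
  have hda : (d : ℝ) ^ a ≤ (d : ℝ) ^ A := Real.rpow_le_rpow_of_exponent_le hd1 (le_max_left _ _)
  have hdb : (d : ℝ) ^ b ≤ (d : ℝ) ^ B := Real.rpow_le_rpow_of_exponent_le hd1 (le_max_left _ _)
  -- `d ≤ (cΔ)^t` in the exponents `A`, `B`
  have hpow : ∀ E : ℝ, 0 ≤ E → (d : ℝ) ^ E ≤ (c * Δ) ^ ((t : ℝ) * E) := fun E hE => by
    calc (d : ℝ) ^ E ≤ ((c * Δ) ^ t) ^ E := Real.rpow_le_rpow hd0 hdle hE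
      _ = (c * Δ) ^ ((t : ℝ) * E) := by
        rw [← Real.rpow_natCast, ← Real.rpow_mul hcΔpos.le]
  have hdA : (d : ℝ) ^ A ≤ (c * Δ) ^ ((t : ℝ) * A) := hpow A hA0
  have hdB : (d : ℝ) ^ B ≤ (c * Δ) ^ ((t : ℝ) * B) := hpow B hB0
  -- first term: `cC d^A ≤ Δ`
  have hI : c * C * (d : ℝ) ^ A ≤ Δ := by
    calc c * C * (d : ℝ) ^ A ≤ c * C * (c * Δ) ^ ((t : ℝ) * A) :=
          mul_le_mul_of_nonneg_left hdA hcC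
      _ = M * Δ ^ ((t : ℝ) * A) := by
          rw [Real.mul_rpow hcpos.le hΔpos.le, hM]; ring
      _ ≤ Δ ^ e * Δ ^ ((t : ℝ) * A) :=
          mul_le_mul_of_nonneg_right hMΔ (Real.rpow_nonneg hΔpos.le _)
      _ = Δ := by
          rw [← Real.rpow_add hΔpos, he, sub_add_cancel, Real.rpow_one]
  have hI' : c * C * (d : ℝ) ^ A * Real.log H ≤ Δ * Real.log H :=
    mul_le_mul_of_nonneg_right hI hL
  -- second term: `cC d^B < Y ≤ d Y`
  have hY0 : 0 ≤ Y := le_trans hΔpos.le (le_max_left _ _)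
  have hII : c * C * (d : ℝ) ^ B < (d : ℝ) * Y := by
    calc c * C * (d : ℝ) ^ B ≤ c * C * (c * Δ) ^ ((t : ℝ) * B) :=
          mul_le_mul_of_nonneg_left hdB hcC
      _ < c * C * (c * Δ) ^ ((t : ℝ) * B) + 1 := lt_add_one _
      _ ≤ Y := le_max_right _ _
      _ ≤ (d : ℝ) * Y := le_mul_of_one_le_left hY0 hd1
  -- assemble
  have h1 : c * C * ((d : ℝ) ^ a * Real.log H) ≤ c * C * ((d : ℝ) ^ A * Real.log H) :=
    mul_le_mul_of_nonneg_left (mul_le_mul_of_nonneg_right hda hL) hcC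
  have h2 : c * C * (d : ℝ) ^ b ≤ c * C * (d : ℝ) ^ B := mul_le_mul_of_nonneg_left hdb hcC
  have hexp : c * (C * ((d : ℝ) ^ a * Real.log H + (d : ℝ) ^ b)) =
      c * C * ((d : ℝ) ^ a * Real.log H) + c * C * (d : ℝ) ^ b := by ring
  rw [hexp]
  linarith [h1, h2, hI', hII]

/-- In a finite cardinal bound, `κ < n` gives `κ ≤ n - 1` (for `n ≥ 1`). [folklore] -/
theorem ApproximationRace.le_pred_of_lt_natCast {κ : Cardinal} {n : ℕ} (hn : 1 ≤ n)
    (h : κ < (n : Cardinal)) : κ ≤ ((n - 1 : ℕ) : Cardinal) := by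
  have : (n : Cardinal) = Order.succ ((n - 1 : ℕ) : Cardinal) := by
    rw [Cardinal.succ_natCast]
    exact_mod_cast (by omega : n = n - 1 + 1)
  rw [this] at h
  exact Order.lt_succ_iff.mp h

/-! ## The item -/

/-- **`ApproximationRace`** (route `DiophantineDichotomy`, support item stmt-Schanuel-6119): Philippon's
approximation property (`ApproximationProperty`) and the simultaneous approximation measure with
degree exponent `a < 1/(n−1)` at free Khovanskii points (`KhovanskiiApproxType`) imply Schanuel's
conjecture at free Khovanskii points (`KhovanskiiSchanuel`): `n = 0` trivial, `n = 1`
Hermite–Lindemann, `n ≥ 2` the exponent race `ApproximationRace.race` at `θ = (s, e^s)` with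
`t = n − 1`. [folklore] -/
theorem approximationRace_proof : ApproximationRace := by
  intro hAP hAT n s hs hg
  rcases Nat.lt_or_ge n 2 with hn | hn
  · interval_cases n
    · simp
    · -- `n = 1`: Hermite–Lindemann
      rw [Nat.cast_one]
      have hs0 : s 0 ≠ 0 := hs.ne_zero 0
      by_cases halg : IsAlgebraic ℚ (s 0)
      · refine ApproximationRace.one_le_trdeg_of_mem
          (IntermediateField.subset_adjoin ℚ _ (Or.inr ⟨0, rfl⟩))
          (Literature.NumberTheory.Transcendental.transcendental_exp_holds halg hs0)
      · exact ApproximationRace.one_le_trdeg_of_mem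
          (IntermediateField.subset_adjoin ℚ _ (Or.inl ⟨0, rfl⟩)) halg
  · -- `n ≥ 2`: the race
    by_contra hlt
    rw [not_le] at hlt
    have hle := ApproximationRace.le_pred_of_lt_natCast (by omega) hlt
    -- transport `trdeg ≤ n - 1` along `range (Sum.elim s (exp ∘ s)) = range s ∪ range (exp ∘ s)`
    -- (stated for a general set: the `ℚ`-algebra instance carries a proof depending on the set)
    have key : ∀ S : Set ℂ, S = Set.range s ∪ Set.range (Complex.exp ∘ s) →
        Algebra.trdeg ℚ ↥(IntermediateField.adjoin ℚ S) ≤ ((n - 1 : ℕ) : Cardinal) := by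
      rintro S rfl
      exact hle
    obtain ⟨c, hc1, hAP'⟩ := hAP (Fin n ⊕ Fin n) (Sum.elim s (Complex.exp ∘ s)) (n - 1)
      (by omega) (key _ (Set.Sum.elim_range _ _))
    obtain ⟨a, b, C, ha, hC, hAT'⟩ := hAT n s hn hs hg
    have ha' : a < 1 / ((n - 1 : ℕ) : ℝ) := by
      rw [Nat.cast_sub (by omega), Nat.cast_one]; exact ha
    obtain ⟨Δ, Y, hcΔ, hΔY, hrace⟩ :=
      ApproximationRace.race (t := n - 1) (by omega) hc1 hC ha'
    obtain ⟨γ, d, H, hfin, hpoly, hd, -, hdist⟩ := hAP' Δ Y hcΔ hΔY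
    have hlow := hAT' d H γ hfin hpoly
    obtain ⟨P, hP0, hPdeg, hPH, hPz⟩ := hpoly (Sum.inl ⟨0, by omega⟩)
    have h1d : 1 ≤ d := ApproximationRace.one_le_of_root hP0 hPdeg hPz
    have h1H : 1 ≤ H := ApproximationRace.one_le_height hP0 hPH
    have hcpos : (0 : ℝ) < c := lt_of_lt_of_le one_pos hc1
    have hsand := (Real.exp_le_exp.mp (hlow.trans hdist))
    -- `-(C·(…)) ≤ -((log H Δ + d Y)/c)`
    have hineq : Real.log H * Δ + d * Y ≤ c * (C * ((d : ℝ) ^ a * Real.log H + (d : ℝ) ^ b)) := by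
      have := neg_le_neg hsand
      rw [neg_neg, neg_neg, div_le_iff₀ hcpos] at this
      linarith
    exact absurd hineq (not_le.mpr (hrace d H h1d h1H hd))

end Summit.Schanuel.Schanuel.Theorems
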